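import Mathlib
import Summits.ValiantsHypothesis.ValiantsHypothesis.Theorems.LacunarySymmetroidMatrixDescartesCensusConfluentClosure

/-!
# `MatrixDescartes` census — confluent closure of door A, CHAIN FORM: 21 alternating sample values suffice

HONEST FRAMING.  Object-search cell `pub-symmetroid`, door-A item `Theses.LacunarySymmetroid.DoorA26 = PosRootLawAt 2 6 19`
(stmt-ValiantsHypothesis-19979; OPEN, typed, never asserted).  This file only repackages the hypothesis of
`…CensusConfluentClosure` (twenty pairwise DISJOINT brackets) into the shape a refuter actually certifies: ONE strictly
increasing chain of `21` sample abscissae `p₀ < ⋯ < p₂₀` (in `t = log x`) at which the confluent determinant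
`det(S₀ + e^{a t}(A + t·B) + e^{d₃ t} S₃ + e^{d₄ t} S₄ + e^{d₅ t} S₅)` alternates strictly in sign.  Nothing is decided:
`DoorA26` stays OPEN, no register moves, nothing bears on `MatrixDescartes` (stmt-ValiantsHypothesis-18050) or `VP ≠ VNP`.

* `le_ncard_of_chain` — for ANY real-exponent `2 × 2` pencil: `n` consecutive strict sign alternations along a strictly
  increasing chain of `n + 1` points give `≥ n` zeros of `t ↦ det ∑_l e^{δ_l t} S_l` (IVT in the `n` disjoint open gaps;
  finiteness from the tree's `le_ncard_of_brackets` applied to one gap);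
* `not_posRootLawAt_2_6_19_of_confluent_chain`, `not_doorA26_of_confluent_chain` — the chain versions of the two theorems
  of `…CensusConfluentClosure` (the honest approximants inherit the 20 consecutive alternations for small `η > 0`).

No confluent pencil with such a chain is claimed to exist.

[folklore] Elementary repackaging (intermediate value theorem on consecutive gaps).
-/

-- `Summit.ValiantsHypothesis.ValiantsHypothesis.…` repeats a component by the D-0017 layout
-- (single-conjunct summit), which the `dupNamespace` linter flags; the name is mandated.
set_option linter.dupNamespace false

namespace Summit.ValiantsHypothesis.ValiantsHypothesis.Theorems.LacunarySymmetroidMatrixDescartes.Census.RealExp.Confluent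

open Filter Topology
open scoped BigOperators Matrix
open Summit.ValiantsHypothesis.ValiantsHypothesis.Theorems.MatrixDescartes.Negative (PosRootLawAt)
open Summit.ValiantsHypothesis.ValiantsHypothesis.Theorems.LacunarySymmetroidMatrixDescartes.Census.RealExp
  (le_ncard_of_brackets ncard_rpow_eq_ncard_exp not_posRootLawAt_two_iff continuous_det_expPencil exists_zero_of_mul_neg)

/-- **From an alternating chain to zeros.**  If `t ↦ det ∑_l e^{δ_l t} S_l` takes values of opposite strict signs at the two
ends of each of the `n ≥ 1` consecutive gaps of a strictly increasing chain `p : Fin (n+1) → ℝ`, then its zero set is finite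
with at least `n` elements. [folklore] -/
theorem le_ncard_of_chain {m K n : ℕ} (δ : Fin K → ℝ) (S : Fin K → Matrix (Fin m) (Fin m) ℝ) (hn : 0 < n)
    (p : Fin (n + 1) → ℝ) (hp : StrictMono p)
    (hsign : ∀ i : Fin n, (∑ l, Real.exp (δ l * p i.castSucc) • S l).det *
      (∑ l, Real.exp (δ l * p i.succ) • S l).det < 0) :
    {t : ℝ | (∑ l, Real.exp (δ l * t) • S l).det = 0}.Finite ∧
      n ≤ {t : ℝ | (∑ l, Real.exp (δ l * t) • S l).det = 0}.ncard := by
  classical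
  have hgap : ∀ i : Fin n, p i.castSucc < p i.succ := fun i => hp (Fin.castSucc_lt_succ (i := i))
  -- finiteness: one bracket suffices
  have hfin : {t : ℝ | (∑ l, Real.exp (δ l * t) • S l).det = 0}.Finite := by
    have h := le_ncard_of_brackets δ S (n := 1) Nat.one_pos (a := fun _ => p (⟨0, hn⟩ : Fin n).castSucc)
      (b := fun _ => p (⟨0, hn⟩ : Fin n).succ) (fun _ => hgap _) (fun i j hij => absurd hij (by omega))
      (fun _ => hsign _)
    exact h.1
  -- one zero in each open gap
  have hzeros : ∀ i : Fin n, ∃ w ∈ Set.Ioo (p i.castSucc) (p i.succ), (∑ l, Real.exp (δ l * w) • S l).det = 0 :=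
    fun i => exists_zero_of_mul_neg (hgap i) (continuous_det_expPencil δ S).continuousOn (hsign i)
  choose w hwmem hw0 using hzeros
  have hwmono : StrictMono w := by
    intro i j hij
    have h1 := (hwmem i).2
    have h2 := (hwmem j).1
    have h3 : p i.succ ≤ p j.castSucc := hp.monotone (by
      change (i : ℕ) + 1 ≤ (j : ℕ)
      exact Nat.succ_le_of_lt hij)
    linarith
  refine ⟨hfin, ?_⟩
  have hsub : Set.range w ⊆ {t | (∑ l, Real.exp (δ l * t) • S l).det = 0} := by
    rintro t ⟨i, rfl⟩; exact hw0 i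
  have h1 := Set.ncard_le_ncard hsub hfin
  rw [Set.ncard_range_of_injective hwmono.injective, Nat.card_eq_fintype_card, Fintype.card_fin] at h1
  exact h1

/-- **A confluent twenty in CHAIN form refutes the (2,6) law**: symmetric letters and `21` strictly increasing abscissae (in
`t = log x`) at which the confluent determinant alternates strictly in sign ⇒ `¬ PosRootLawAt 2 6 19`. [folklore] -/
theorem not_posRootLawAt_2_6_19_of_confluent_chain (a d₃ d₄ d₅ : ℝ) {S₀ A B S₃ S₄ S₅ : Matrix (Fin 2) (Fin 2) ℝ}
    (h₀ : S₀.IsSymm) (hA : A.IsSymm) (hB : B.IsSymm) (h₃ : S₃.IsSymm) (h₄ : S₄.IsSymm) (h₅ : S₅.IsSymm)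
    (p : Fin 21 → ℝ) (hp : StrictMono p)
    (hsign : ∀ i : Fin 20,
      (S₀ + Real.exp (a * p i.castSucc) • (A + p i.castSucc • B) + Real.exp (d₃ * p i.castSucc) • S₃ +
          Real.exp (d₄ * p i.castSucc) • S₄ + Real.exp (d₅ * p i.castSucc) • S₅).det *
        (S₀ + Real.exp (a * p i.succ) • (A + p i.succ • B) + Real.exp (d₃ * p i.succ) • S₃ +
          Real.exp (d₄ * p i.succ) • S₄ + Real.exp (d₅ * p i.succ) • S₅).det < 0) :
    ¬ PosRootLawAt 2 6 19 := by
  have hev : ∀ᶠ η in 𝓝[>] (0 : ℝ), 0 < η ∧ ∀ i : Fin 20,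
      (∑ l, Real.exp (((![0, a, a + η, d₃, d₄, d₅] : Fin 6 → ℝ) l) * p i.castSucc) •
          ((![S₀, A - η⁻¹ • B, η⁻¹ • B, S₃, S₄, S₅] : Fin 6 → Matrix (Fin 2) (Fin 2) ℝ) l)).det *
        (∑ l, Real.exp (((![0, a, a + η, d₃, d₄, d₅] : Fin 6 → ℝ) l) * p i.succ) •
          ((![S₀, A - η⁻¹ • B, η⁻¹ • B, S₃, S₄, S₅] : Fin 6 → Matrix (Fin 2) (Fin 2) ℝ) l)).det < 0 := by
    have hall : ∀ᶠ η in 𝓝[>] (0 : ℝ), ∀ i : Fin 20,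
        (∑ l, Real.exp (((![0, a, a + η, d₃, d₄, d₅] : Fin 6 → ℝ) l) * p i.castSucc) •
            ((![S₀, A - η⁻¹ • B, η⁻¹ • B, S₃, S₄, S₅] : Fin 6 → Matrix (Fin 2) (Fin 2) ℝ) l)).det *
          (∑ l, Real.exp (((![0, a, a + η, d₃, d₄, d₅] : Fin 6 → ℝ) l) * p i.succ) •
            ((![S₀, A - η⁻¹ • B, η⁻¹ • B, S₃, S₄, S₅] : Fin 6 → Matrix (Fin 2) (Fin 2) ℝ) l)).det < 0 := by
      refine eventually_all.2 fun i => ?_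
      have hprod := (tendsto_det_approx a d₃ d₄ d₅ S₀ A B S₃ S₄ S₅ (p i.castSucc)).mul
        (tendsto_det_approx a d₃ d₄ d₅ S₀ A B S₃ S₄ S₅ (p i.succ))
      exact hprod.eventually (Iio_mem_nhds (hsign i))
    filter_upwards [(self_mem_nhdsWithin : Set.Ioi (0 : ℝ) ∈ 𝓝[>] (0 : ℝ)), hall] with η hη h using ⟨hη, h⟩
  obtain ⟨η, -, hη⟩ := hev.exists
  set δ' : Fin 6 → ℝ := (![0, a, a + η, d₃, d₄, d₅] : Fin 6 → ℝ) with hδ'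
  set S' : Fin 6 → Matrix (Fin 2) (Fin 2) ℝ :=
    (![S₀, A - η⁻¹ • B, η⁻¹ • B, S₃, S₄, S₅] : Fin 6 → Matrix (Fin 2) (Fin 2) ℝ) with hS'
  have hcount := (le_ncard_of_chain δ' S' (by norm_num : 0 < 20) p hp hη).2
  rw [← ncard_rpow_eq_ncard_exp δ' S'] at hcount
  exact (not_posRootLawAt_two_iff 6 19).mpr ⟨δ', S', approxLetters_isSymm h₀ hA hB h₃ h₄ h₅ η, hcount⟩

/-- **Confluent closure of door A, chain form**: `21` strictly increasing abscissae with strictly alternating confluent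
determinant values refute `Theses.LacunarySymmetroid.DoorA26`.  No such pencil is claimed to exist; the door stays OPEN.
[folklore] -/
theorem not_doorA26_of_confluent_chain (a d₃ d₄ d₅ : ℝ) {S₀ A B S₃ S₄ S₅ : Matrix (Fin 2) (Fin 2) ℝ}
    (h₀ : S₀.IsSymm) (hA : A.IsSymm) (hB : B.IsSymm) (h₃ : S₃.IsSymm) (h₄ : S₄.IsSymm) (h₅ : S₅.IsSymm)
    (p : Fin 21 → ℝ) (hp : StrictMono p)
    (hsign : ∀ i : Fin 20,
      (S₀ + Real.exp (a * p i.castSucc) • (A + p i.castSucc • B) + Real.exp (d₃ * p i.castSucc) • S₃ +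
          Real.exp (d₄ * p i.castSucc) • S₄ + Real.exp (d₅ * p i.castSucc) • S₅).det *
        (S₀ + Real.exp (a * p i.succ) • (A + p i.succ • B) + Real.exp (d₃ * p i.succ) • S₃ +
          Real.exp (d₄ * p i.succ) • S₄ + Real.exp (d₅ * p i.succ) • S₅).det < 0) :
    ¬ Summit.ValiantsHypothesis.ValiantsHypothesis.Theses.LacunarySymmetroid.DoorA26 := by
  intro hD
  exact not_posRootLawAt_2_6_19_of_confluent_chain a d₃ d₄ d₅ h₀ hA hB h₃ h₄ h₅ p hp hsign fun d S hS => hD d S hS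

end Summit.ValiantsHypothesis.ValiantsHypothesis.Theorems.LacunarySymmetroidMatrixDescartes.Census.RealExp.Confluent
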